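import Literature.AnabelianGeometry.EtaleTheta.Discharge.Sec5ThetaSubquotientProjGaloisPinned
import Literature.AnabelianGeometry.EtaleTheta.Discharge.Sec5Prop55QPBindersAtSettingQ
import HarnessLib

/-!
# [EtTh] Prop. 5.5 / Thm. 5.6 (i) at the §5 data OF THE SETTING, print's `Q`: abc-iut-L2-t9's `(Q, P)`-binder kit ON THE v2 SUBQUOTIENT RECORD
# `ThetaSubquotientProjGalois` (surjective at Galois objects only; proof-only)

Mochizuki, *The étale theta function and its Frobenioid-theoretic manifestations*, Publ. RIMS **45** (2009), §5 p. 327 (PDF p. 101), proof of Prop. 5.5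
pp. 327–328 (PDF pp. 101–102) [cite: MochizukiEtTh2009, Prop 5.5 p.327–328 (PDF pp.101–102)].

abc-iut cell, layer L2, seat abc-iut-w6-d079 (gen 6), row «(w4) V1→V2» tranche 1 item (c) (abc-iut-L2-lead g7 R925).  PROOF-ONLY (0 definitions).
abc-iut-L2-t9's print's-`Q` kit `Sec5Prop55QPBindersAtSettingQ.lean` (p447951) and the coefficient-map theorem of `Sec5Prop55HPprojAtSettingQ.lean`
(p445332) derive the `(Q, P)`-binders {hpre, hcov', hgeom, hcovHB, hproj, (e, he, hPproj)} of the Prop. 5.5 / Thm. 5.6 (i) end knits at abc-iut-L2-t4's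
junction object `ofThetaSettingDataQ μ hC hS h R K' …` from the two PIN EQUATIONS `hPpre` / `hPproj_pin` on an arbitrary `P : ThetaSubquotientProj _`
— abc-iut-L2-t4's v1 record, for which «no `P` TERM is constructed».  Here the SAME derivations are re-run VERBATIM (as `private` helpers — their statements coincide with the v1 ones up to the binder type) on abc-iut-w6-d079's v2
record `P : ThetaSubquotientProjGalois _ (IsGaloisObj ·.obj)` (p481123); on that record a term SATISFYING BOTH PINS EXISTS
(`Sec5ThetaSubquotientProjGaloisPinned.lean`, `exists_thetaSubquotientProjGalois_pinned_ofThetaSettingDataQ`), so the kit's pin hypotheses are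
DISCHARGEABLE — see `exists_thetaSubquotientProjGalois_qpBinders_ofThetaSettingDataQ` at the end: SOME v2 term carries hpre ∧ hcov' ∧ hgeom ∧
hcovHB with no pin binder left.  The `P`-free producers (`mapAut_rho_mem_autPre_ofThetaSetting_of_mem`, `exists_toTheta_mem_eq_mapAut_rho_ofThetaSetting`,
`exists_map_autProj_mapAut_conj`, `ofThetaSettingDataQ_lDeltaMap`, `exists_coeffMap_autProj_ofThetaSetting`) are consumed BY NAME.

HONEST FRAMING: kernel-checked implications between the cell's typed statements at abc-iut-L2-t9's carrier; nothing asserts that [EtTh]'s data exist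
for an actual curve (`tf` abstract); [EtTh] is refereed; nothing here bears on [IUTchIII] Cor. 3.12 — no side taken; typed ≠ proved.
-/

noncomputable section

namespace Literature.AnabelianGeometry.EtaleTheta

open CategoryTheory Opposite FrobenioidCyclotomicRigidity Literature.AlgebraicGeometry.Frobenioids
  Literature.AnabelianGeometry.SemiGraphs Literature.AnabelianGeometry.SemiGraphs.GaloisObjects ThetaSubquotient
open scoped IsMulCommutative

universe v₀

namespace ThetaFrobenioid

section SettingQPGalois

variable {p : ℕ} [Fact p.Prime] {D : ThetaSetting p} {E : D.EtaleThetaData} {l : ℕ} {C : E.DoubleUnderline l}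
  {e : D.toTemperedCurve.GroupLevelData} {N : ℕ+} (μ : D.CyclotomeMod l N) (hC : D.Compat) (hS : D.Sec2Hyps)
  {D₀ : Type} [Category.{v₀} D₀] {V : FrdIMonoidStub.{0}} {T₀ : RealifiedDivisorMonoids (D₀ := D₀) V}
  {VD : FrdICatStub.{1, 0, 0} (ConnectedPart (BTemp (C.temperedArithmeticGroup e).Pi))}
  {tf : TemperedFrobenioid T₀ (ConnectedPart (BTemp (C.temperedArithmeticGroup e).Pi)) VD} {hZ : tf.monoidType = MonoidType.Z}
  {hP : ∀ A : (ConnectedPart (BTemp (C.temperedArithmeticGroup e).Pi))ᵒᵖ, IsPerfect (tf.Φ.carrier A)}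
  {NH : Subgroup (Field.absoluteGaloisGroup D.K) → tf.category → ℕ+ → Prop} {A₀ : tf.category}
  {hA₀ : PreFrobenioid.IsFrobeniusTrivial tf.toElem A₀} {hA₀' : SemiGraphs.IsGaloisObj A₀.base.obj}
  {pullFrac : ∀ {A A' : (BiKummerSetting.mkOfConnectedTemperoid (C.temperedArithmeticGroup e) tf hZ hP NH A₀ hA₀ hA₀').C} (_ : A' ⟶ A),
    (BiKummerSetting.mkOfConnectedTemperoid (C.temperedArithmeticGroup e) tf hZ hP NH A₀ hA₀ hA₀').biratUnits A →
      (BiKummerSetting.mkOfConnectedTemperoid (C.temperedArithmeticGroup e) tf hZ hP NH A₀ hA₀ hA₀').biratUnits A'}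
  {θ : (BiKummerSetting.mkOfConnectedTemperoid (C.temperedArithmeticGroup e) tf hZ hP NH A₀ hA₀ hA₀').biratUnits
    (BiKummerSetting.mkOfConnectedTemperoid (C.temperedArithmeticGroup e) tf hZ hP NH A₀ hA₀ hA₀').Aodot}
  {Bl : (BiKummerSetting.mkOfConnectedTemperoid (C.temperedArithmeticGroup e) tf hZ hP NH A₀ hA₀ hA₀').C}
  {Pl : (BiKummerSetting.mkOfConnectedTemperoid (C.temperedArithmeticGroup e) tf hZ hP NH A₀ hA₀ hA₀').FractionPair θ Bl}
  {Rl : (BiKummerSetting.mkOfConnectedTemperoid (C.temperedArithmeticGroup e) tf hZ hP NH A₀ hA₀ hA₀').NthRoot θ Pl C.lPNat pullFrac}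
  (h : ModelFrobenioid.Hypotheses tf.divisorMonoid tf.ratFnFunctor)
  (R : (BiKummerSetting.mkOfConnectedTemperoid (C.temperedArithmeticGroup e) tf hZ hP NH A₀ hA₀ hA₀').NthRoot Rl.root Rl.pair N pullFrac)
  (K' : Type) [Field K'] (constEmb : K'ˣ →* tf.biratUnitsModel R.BN) (constEmb_injective : Function.Injective constEmb)
  (hinvc : ∀ g : Aut R.AN.base,
    pull tf.divisorMonoid g.hom (ModelFrobenioid.div R.pair.num) = ModelFrobenioid.div R.pair.num)
  (hinvp : ∀ y : (C.thetaEnvData μ hC hS).PiX, y ∈ (C.thetaEnvData μ hC hS).PiYdd →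
    pull tf.divisorMonoid ((BiKummerSetting.mkOfConnectedTemperoid (C.temperedArithmeticGroup e) tf hZ hP NH A₀ hA₀ hA₀').galoisSurj
      R.AN.base R.αData.isGalois ((ContinuousMulEquiv.refl _) y)).hom (ModelFrobenioid.div R.pair.den) = ModelFrobenioid.div R.pair.den)
  (h15 : ThetaSetting.Prop15iii E hC) (L : C.CuspLabels)
  (P : ThetaSubquotientProjGalois (ofThetaSettingDataQ μ hC hS h R K' constEmb constEmb_injective hinvc hinvp) fun F => SemiGraphs.IsGaloisObj F.obj)
  (hPpre : P.pre R.BN.base = (autPre (qSub D C.Huu) (ιTheta D l) R.BN.base.obj).comap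
    (Functor.mapAut R.BN.base (connectedObjects (BTemp (C.temperedArithmeticGroup e).Pi)).ι))

/-! ### The `(Q, P)`-binders on the v2 record, under the pin `hPpre` (and `hPproj_pin`) -/

include hPpre

/-- (v2 record; abc-iut-L2-t9's p447951 VERBATIM.) **hpre at the junction object** (⟸ `hPpre`): for `k ∈ Π^tp_Ÿ̲̲` with `k ∈ RD.lDeltaTheta` (⟺ `toTheta k ∈ l·Δ_Θ`, abc-iut-L2-t4's `Iff.rfl`),
`ρ k ∈ P_{B_N^bs}` — in the binder type of p430047 / p437254.  [cite: MochizukiEtTh2009, §5 p.327 (PDF p.101)] -/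
private theorem hpre_ofThetaSettingDataQ_galois_of_pin :
    ∀ k : (C.rigidData μ hC hS h15 L).PiYdd, (k : (C.rigidData μ hC hS h15 L).PiX) ∈ (C.rigidData μ hC hS h15 L).lDeltaTheta →
      rhoOfBiKummerData (T := C.thetaEnvData μ hC hS) R (ContinuousMulEquiv.refl _) k ∈ P.pre R.BN.base := by
  intro k hk
  rw [hPpre]
  exact mapAut_rho_mem_autPre_ofThetaSetting_of_mem μ hC hS R k hk

/-- (v2 record; p447951 VERBATIM.) **hcov' at the junction object** (⟸ `hPpre`): EVERY element of `P_{B_N^bs}` is `ρ k` for some `k ∈ Π^tp_Ÿ̲̲` with `k ∈ RD.lDeltaTheta`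
(abc-iut-L2-t4's pointwise `exists_toTheta_mem_eq_mapAut_rho_ofThetaSetting` + `(l·Δ_Θ) ≤ Π^tp_Ÿ̲̲`, `RigidData.lDeltaTheta_le`; the passage
`mapAut (ρ k) = mapAut g ⇒ ρ k = g` is faithfulness of `Aut_D(B_N^bs) ↪ Aut(B_N^bs.obj)`).
[cite: MochizukiEtTh2009, Prop 5.5 proof p.327–328 (PDF pp.101–102)] -/
private theorem hcov'_ofThetaSettingDataQ_galois_of_pin :
    ∀ g ∈ P.pre ((ofThetaSettingDataQ μ hC hS h R K' constEmb constEmb_injective hinvc hinvp).base.obj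
        (ofThetaSettingDataQ μ hC hS h R K' constEmb constEmb_injective hinvc hinvp).BN),
      ∃ k : (C.rigidData μ hC hS h15 L).PiYdd, (k : (C.rigidData μ hC hS h15 L).PiX) ∈ (C.rigidData μ hC hS h15 L).lDeltaTheta ∧
        rhoOfBiKummerData (T := C.thetaEnvData μ hC hS) R (ContinuousMulEquiv.refl _) k = g := by
  intro g hg
  have hg' : g ∈ P.pre R.BN.base := hg
  rw [hPpre] at hg'
  have H := exists_toTheta_mem_eq_mapAut_rho_ofThetaSetting μ hC hS h R K' constEmb constEmb_injective hinvc hinvp hg'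
  obtain ⟨k, hk, hρ⟩ := H
  exact ⟨⟨k, ((C.rigidData μ hC hS h15 L).lDeltaTheta_le hk).1⟩, hk, Iso.ext (ObjectProperty.hom_ext _ (congrArg Iso.hom hρ))⟩

/-- (v2 record; p447951 VERBATIM.) **hgeom at the junction object** (⟸ `hPpre`): `P_{B_N^bs} ≤ ρ(Ker aug)` (`(l·Δ_Θ) ≤ Δ^tp_{X̲̲}`, `RigidData.lDeltaTheta_le`).
[cite: MochizukiEtTh2009, §5 p.327 (PDF p.101); §2 p.45] -/
private theorem hgeom_ofThetaSettingDataQ_galois_of_pin :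
    P.pre R.BN.base ≤ (C.rigidData μ hC hS h15 L).aug.ker.map
      (rhoOfBiKummerData (T := C.thetaEnvData μ hC hS) R (ContinuousMulEquiv.refl _)) := by
  intro g hg
  have H := hcov'_ofThetaSettingDataQ_galois_of_pin μ hC hS h R K' constEmb constEmb_injective hinvc hinvp h15 L P hPpre g hg
  obtain ⟨k, hk, hρ⟩ := H
  exact ⟨k, ((C.rigidData μ hC hS h15 L).lDeltaTheta_le hk).2, hρ⟩

/-- (v2 record; p447951 VERBATIM.) **hcovHB at the junction object** (⟸ `hPpre`): an element of `H_{B_N} = ρ(Π^tp_Ÿ̲̲)` lying in `P_{B_N^bs}` IS `ρ y` with `y ∈ Π^tp_Ÿ̲̲ ∩ (l·Δ_Θ)`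
(`𝔉.ρ = ρ` definitionally) — NO lift inside `H_⊙` needed.  [cite: MochizukiEtTh2009, Prop 5.5 proof p.327–328 (PDF pp.101–102)] -/
private theorem hcovHB_ofThetaSettingDataQ_galois_of_pin :
    ∀ k : (ofThetaSettingDataQ μ hC hS h R K' constEmb constEmb_injective hinvc hinvp).HB,
      (k : Aut ((ofThetaSettingDataQ μ hC hS h R K' constEmb constEmb_injective hinvc hinvp).base.obj
        (ofThetaSettingDataQ μ hC hS h R K' constEmb constEmb_injective hinvc hinvp).BN)) ∈ P.pre _ →
      ∃ (y : (C.rigidData μ hC hS h15 L).PiX) (_ : y ∈ (C.rigidData μ hC hS h15 L).PiYdd),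
        (ofThetaSettingDataQ μ hC hS h R K' constEmb constEmb_injective hinvc hinvp).ρ y = k ∧
          y ∈ (C.rigidData μ hC hS h15 L).lDeltaTheta := by
  intro k hm
  have H := hcov'_ofThetaSettingDataQ_galois_of_pin μ hC hS h R K' constEmb constEmb_injective hinvc hinvp h15 L P hPpre _ hm
  obtain ⟨y, hy, hρ⟩ := H
  exact ⟨y, y.2, hρ, hy⟩

/-! ### 3. Under both pins: the structural leaf `hproj` and the coefficient map `(e, he, hPproj)` -/

/-- (v2 record; p447951 VERBATIM.) **hproj at the junction object** (⟸ both pins): `𝔉.lDeltaMap g (P.proj g′) = P.proj (g g′ g⁻¹)` at `B_N^bs` — abc-iut-w4-d042's conjugation law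
`ThetaSubquotient.map_autProj_eq_autProj_conj` (p429126) read through the `rfl` dictionary (`𝔉.lDeltaMap` at the pinned stub IS abc-iut-L2-t9's
transport `map q ι`) and the two pins; the print's-`Q` twin of abc-iut-w4-d042's `hproj_levelStub_of_pins` (p444002).
[cite: MochizukiEtTh2009, Prop 5.5 proof p.328 (PDF p.102)] -/
private theorem hproj_ofThetaSettingDataQ_galois_of_pins
    (hPproj_pin : ∀ (σ : P.pre R.BN.base) (τ : autPre (qSub D C.Huu) (ιTheta D l) R.BN.base.obj),
      Functor.mapAut R.BN.base (connectedObjects (BTemp (C.temperedArithmeticGroup e).Pi)).ι σ.1 = τ.1 →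
        P.proj R.BN.base σ = autProj (qSub D C.Huu) (ιTheta D l) R.BN.base.obj τ)
    (g g' : Aut R.BN.base) (hh : g' ∈ P.pre R.BN.base) :
    ∃ hgh : g * g' * g⁻¹ ∈ P.pre R.BN.base,
      (ofThetaSettingDataQ μ hC hS h R K' constEmb constEmb_injective hinvc hinvp).lDeltaMap g.hom (P.proj R.BN.base ⟨g', hh⟩) =
        P.proj R.BN.base ⟨g * g' * g⁻¹, hgh⟩ := by
  have hh' : Functor.mapAut R.BN.base (connectedObjects (BTemp (C.temperedArithmeticGroup e).Pi)).ι g' ∈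
      autPre (qSub D C.Huu) (ιTheta D l) R.BN.base.obj := by
    rw [hPpre] at hh
    exact hh
  have H := exists_map_autProj_mapAut_conj (qSub D C.Huu) (ιTheta D l) R.BN.base g g' hh'
  obtain ⟨hgh', h3⟩ := H
  have hgh : g * g' * g⁻¹ ∈ P.pre R.BN.base := by
    rw [hPpre]
    exact hgh'
  refine ⟨hgh, ?_⟩
  have h1 := hPproj_pin ⟨g', hh⟩ ⟨_, hh'⟩ rfl
  have h2 := hPproj_pin ⟨g * g' * g⁻¹, hgh⟩ ⟨_, hgh'⟩ rfl
  -- term-mode chain (no `rw` on the goal: its motive type-checks exceed the default heartbeat budget at these data)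
  have h4 := (congrArg (fun c => (ofThetaSettingDataQ μ hC hS h R K' constEmb constEmb_injective hinvc hinvp).lDeltaMap g.hom c) h1).trans
    ((ofThetaSettingDataQ_lDeltaMap μ hC hS h R K' constEmb constEmb_injective hinvc hinvp g.hom _).trans h3)
  exact h4.trans h2.symm

/-- (v2 record; abc-iut-L2-t9's p445332 `exists_coeffMap_ofThetaSettingDataQ` VERBATIM.) **The binders `(e, he, hPproj)` of [EtTh] Prop. 5.5 DISCHARGED at the §5 data OF THE SETTING with print's `Q`** (abc-iut-L2-t4's
`𝔉 := ofThetaSettingDataQ μ hC hS h R K' …`, `Q = ofSettingSub D l C.Huu`), in EXACTLY the binder types of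
`cyclotomicRigidity_ofConnectedTemperoidData_of_pullRoot` (p430047) / `exists_rigidityFamily_unique_preserved_ofConnectedTemperoidData_capstone`
(p437254) read at `(X, RD, ιX) := (Π^tp_X̲̲, C.rigidData μ hC hS h15 L, id)`: for ANY `P : ThetaSubquotientProj 𝔉` which AT `B_N^bs` is print's
`Aut`-subquotient — `hPpre : P.pre B_N^bs = (autPre q ι).comap mapAut` (abc-iut-w4-d042's pin) and `hPproj : P.proj B_N^bs = autProj q ι ∘ mapAut` —
there is a SURJECTIVE `e : μ_N → (l·Δ_Θ)_{B_N} ⊗ ℤ/Nℤ` with `mk (P.proj (ρ k)) = e (thetaMod k)` for every `k ∈ Π^tp_Ÿ̲̲ ∩ (l·Δ_Θ)`.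
(No `P` TERM is built: `proj_surjective` at every object is GAP G-w4d042g3-1.)  [cite: MochizukiEtTh2009, Prop 5.5 p.327–328 (PDF pp.101–102)] -/
theorem exists_coeffMap_ofThetaSettingDataQ_galois
    (hPproj : ∀ (σ : Aut R.BN.base) (h₁ : σ ∈ P.pre R.BN.base)
        (h₂ : (Functor.mapAut R.BN.base (connectedObjects (BTemp (C.temperedArithmeticGroup e).Pi)).ι) σ ∈
          autPre (qSub D C.Huu) (ιTheta D l) R.BN.base.obj),
        P.proj R.BN.base ⟨σ, h₁⟩ = autProj (qSub D C.Huu) (ιTheta D l) R.BN.base.obj ⟨_, h₂⟩) :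
    ∃ ec : (C.rigidData μ hC hS h15 L).mu →
        (ofThetaSettingDataQ μ hC hS h R K' constEmb constEmb_injective hinvc hinvp).lDeltaModN
          (ofThetaSettingDataQ μ hC hS h R K' constEmb constEmb_injective hinvc hinvp).BN,
      Function.Surjective ec ∧
        ∀ (k : (C.rigidData μ hC hS h15 L).PiYdd) (hk : (k : (C.rigidData μ hC hS h15 L).PiX) ∈ (C.rigidData μ hC hS h15 L).lDeltaTheta)
          (hm : rhoOfBiKummerData (T := C.thetaEnvData μ hC hS) R (ContinuousMulEquiv.refl _) k ∈ P.pre _),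
          (QuotientGroup.mk (P.proj _ ⟨rhoOfBiKummerData (T := C.thetaEnvData μ hC hS) R (ContinuousMulEquiv.refl _) k, hm⟩) :
              (ofThetaSettingDataQ μ hC hS h R K' constEmb constEmb_injective hinvc hinvp).lDeltaModN
                (ofThetaSettingDataQ μ hC hS h R K' constEmb constEmb_injective hinvc hinvp).BN) =
            ec ((C.rigidData μ hC hS h15 L).thetaMod ⟨k, hk⟩) := by
  have H := exists_coeffMap_autProj_ofThetaSetting μ hC hS R h15 L
  obtain ⟨e', he', hPe'⟩ := H
  refine ⟨e', he', fun k hk hm => ?_⟩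
  have h₂ : ((Functor.mapAut R.BN.base (connectedObjects (BTemp (C.temperedArithmeticGroup e).Pi)).ι).comp
      (rhoOfBiKummerData (T := C.thetaEnvData μ hC hS) R (ContinuousMulEquiv.refl _))) (k : C.Huu) ∈
        autPre (qSub D C.Huu) (ιTheta D l) R.BN.base.obj := by
    have h' : rhoOfBiKummerData (T := C.thetaEnvData μ hC hS) R (ContinuousMulEquiv.refl _) k ∈
        (autPre (qSub D C.Huu) (ιTheta D l) R.BN.base.obj).comap
          (Functor.mapAut R.BN.base (connectedObjects (BTemp (C.temperedArithmeticGroup e).Pi)).ι) := hPpre ▸ hm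
    exact Subgroup.mem_comap.1 h'
  exact (congrArg (QuotientGroup.mk (s := (powMonoidHom (N : ℕ) : LDelta (qSub D C.Huu) (ιTheta D l) R.BN.base.obj →*
      LDelta (qSub D C.Huu) (ιTheta D l) R.BN.base.obj).range)) (hPproj _ hm h₂)).trans (hPe' k hk h₂)


/-- (v2 record; p447951 VERBATIM.) **`(e, he, hPproj)` at the junction object under both pins** (the cell's cast-free projection pin): there is a SURJECTIVE
`e : μ_N → (l·Δ_Θ)_{B_N} ⊗ ℤ/Nℤ` with `mk (P.proj (ρ k)) = e (thetaMod k)` for every `k ∈ Π^tp_Ÿ̲̲ ∩ (l·Δ_Θ)` — abc-iut-L2-t9's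
`exists_coeffMap_autProj_ofThetaSetting` (p445332) read on `P` through the pins ("`l·Δ_Θ ↠ (l·Δ_Θ) ⊗ ℤ/Nℤ ≅ μ_N`", p.46).
[cite: MochizukiEtTh2009, Prop 5.5 p.327–328 (PDF pp.101–102); §2 p.272 (PDF p.46)] -/
private theorem exists_coeffMap_ofThetaSettingDataQ_galois_of_projPin
    (hPproj_pin : ∀ (σ : P.pre R.BN.base) (τ : autPre (qSub D C.Huu) (ιTheta D l) R.BN.base.obj),
      Functor.mapAut R.BN.base (connectedObjects (BTemp (C.temperedArithmeticGroup e).Pi)).ι σ.1 = τ.1 →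
        P.proj R.BN.base σ = autProj (qSub D C.Huu) (ιTheta D l) R.BN.base.obj τ) :
    ∃ ec : (C.rigidData μ hC hS h15 L).mu →
        (ofThetaSettingDataQ μ hC hS h R K' constEmb constEmb_injective hinvc hinvp).lDeltaModN
          (ofThetaSettingDataQ μ hC hS h R K' constEmb constEmb_injective hinvc hinvp).BN,
      Function.Surjective ec ∧
        ∀ (k : (C.rigidData μ hC hS h15 L).PiYdd) (hk : (k : (C.rigidData μ hC hS h15 L).PiX) ∈ (C.rigidData μ hC hS h15 L).lDeltaTheta)
          (hm : rhoOfBiKummerData (T := C.thetaEnvData μ hC hS) R (ContinuousMulEquiv.refl _) k ∈ P.pre _),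
          (QuotientGroup.mk (P.proj _ ⟨rhoOfBiKummerData (T := C.thetaEnvData μ hC hS) R (ContinuousMulEquiv.refl _) k, hm⟩) :
              (ofThetaSettingDataQ μ hC hS h R K' constEmb constEmb_injective hinvc hinvp).lDeltaModN
                (ofThetaSettingDataQ μ hC hS h R K' constEmb constEmb_injective hinvc hinvp).BN) =
            ec ((C.rigidData μ hC hS h15 L).thetaMod ⟨k, hk⟩) :=
  exists_coeffMap_ofThetaSettingDataQ_galois μ hC hS h R K' constEmb constEmb_injective hinvc hinvp h15 L P hPpre
    (fun σ h₁ h₂ => hPproj_pin ⟨σ, h₁⟩ ⟨_, h₂⟩ rfl)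

/-! ### The pins DISCHARGED: some v2 term carries the whole kit -/

omit hPpre in
/-- **The `(Q, P)`-binder kit WITH NO PIN BINDER, on the v2 record**: at the junction object SOME
`P : ThetaSubquotientProjGalois _ (IsGaloisObj ·.obj)` — the term of abc-iut-w6-d079's `exists_thetaSubquotientProjGalois_pinned_ofThetaSettingDataQ`
(p486065), which satisfies abc-iut-w4-d042's / abc-iut-L2-t9's pins `hPpre` and `hPproj_pin` BY CONSTRUCTION — carries hpre ∧ hcov' ∧ hgeom ∧ hproj ∧
(e, he, hPproj) in the binder types of the Prop. 5.5 / Thm. 5.6 (i) end knits (abc-iut-L2-t9's p447951 derivations, re-run on the v2 binder as the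
`private` helpers above — their statements coincide with the v1 ones up to the binder type).  For the v1 record this packaging was impossible
(«no `P` TERM is constructed», p447951). [cite: MochizukiEtTh2009, Prop 5.5 p.327–328 (PDF pp.101–102)] -/
theorem exists_thetaSubquotientProjGalois_qpBinders_ofThetaSettingDataQ :
    ∃ P' : ThetaSubquotientProjGalois (ofThetaSettingDataQ μ hC hS h R K' constEmb constEmb_injective hinvc hinvp) fun F => SemiGraphs.IsGaloisObj F.obj,
      (∀ k : (C.rigidData μ hC hS h15 L).PiYdd, (k : (C.rigidData μ hC hS h15 L).PiX) ∈ (C.rigidData μ hC hS h15 L).lDeltaTheta → rhoOfBiKummerData (T := C.thetaEnvData μ hC hS) R (ContinuousMulEquiv.refl _) k ∈ P'.pre R.BN.base) ∧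
      (∀ g ∈ P'.pre R.BN.base, ∃ k : (C.rigidData μ hC hS h15 L).PiYdd, (k : (C.rigidData μ hC hS h15 L).PiX) ∈ (C.rigidData μ hC hS h15 L).lDeltaTheta ∧ rhoOfBiKummerData (T := C.thetaEnvData μ hC hS) R (ContinuousMulEquiv.refl _) k = g) ∧
      (P'.pre R.BN.base ≤ (C.rigidData μ hC hS h15 L).aug.ker.map (rhoOfBiKummerData (T := C.thetaEnvData μ hC hS) R (ContinuousMulEquiv.refl _))) ∧
      (∀ (g g' : Aut R.BN.base) (hh : g' ∈ P'.pre R.BN.base), ∃ hgh : g * g' * g⁻¹ ∈ P'.pre R.BN.base,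
        (ofThetaSettingDataQ μ hC hS h R K' constEmb constEmb_injective hinvc hinvp).lDeltaMap g.hom (P'.proj R.BN.base ⟨g', hh⟩) = P'.proj R.BN.base ⟨g * g' * g⁻¹, hgh⟩) ∧
      ∃ ec : (C.rigidData μ hC hS h15 L).mu → (ofThetaSettingDataQ μ hC hS h R K' constEmb constEmb_injective hinvc hinvp).lDeltaModN (ofThetaSettingDataQ μ hC hS h R K' constEmb constEmb_injective hinvc hinvp).BN,
        Function.Surjective ec ∧
          ∀ (k : (C.rigidData μ hC hS h15 L).PiYdd) (hk : (k : (C.rigidData μ hC hS h15 L).PiX) ∈ (C.rigidData μ hC hS h15 L).lDeltaTheta) (hm : rhoOfBiKummerData (T := C.thetaEnvData μ hC hS) R (ContinuousMulEquiv.refl _) k ∈ P'.pre _),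
            (QuotientGroup.mk (P'.proj _ ⟨rhoOfBiKummerData (T := C.thetaEnvData μ hC hS) R (ContinuousMulEquiv.refl _) k, hm⟩) : (ofThetaSettingDataQ μ hC hS h R K' constEmb constEmb_injective hinvc hinvp).lDeltaModN (ofThetaSettingDataQ μ hC hS h R K' constEmb constEmb_injective hinvc hinvp).BN) = ec ((C.rigidData μ hC hS h15 L).thetaMod ⟨k, hk⟩) := by
  refine (exists_thetaSubquotientProjGalois_pinned_ofThetaSettingDataQ μ hC hS h R K' constEmb constEmb_injective
    hinvc hinvp).imp fun P' hP' => ?_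
  exact ⟨hpre_ofThetaSettingDataQ_galois_of_pin μ hC hS h R K' constEmb constEmb_injective hinvc hinvp h15 L P' (hP'.1 R.BN.base),
    hcov'_ofThetaSettingDataQ_galois_of_pin μ hC hS h R K' constEmb constEmb_injective hinvc hinvp h15 L P' (hP'.1 R.BN.base),
    hgeom_ofThetaSettingDataQ_galois_of_pin μ hC hS h R K' constEmb constEmb_injective hinvc hinvp h15 L P' (hP'.1 R.BN.base),
    fun g g' hh => hproj_ofThetaSettingDataQ_galois_of_pins μ hC hS h R K' constEmb constEmb_injective hinvc hinvp P'
      (hP'.1 R.BN.base) (hP'.2 R.BN.base) g g' hh,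
    exists_coeffMap_ofThetaSettingDataQ_galois_of_projPin μ hC hS h R K' constEmb constEmb_injective hinvc hinvp h15 L P'
      (hP'.1 R.BN.base) (hP'.2 R.BN.base)⟩

end SettingQPGalois

end ThetaFrobenioid

end Literature.AnabelianGeometry.EtaleTheta

end
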